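import Literature.AnabelianGeometry.SemiGraphs.PSCSeparatingCoveringsUnrConsumers
import Literature.AnabelianGeometry.SemiGraphs.PSCSeparatingCoveringsProofs2
import HarnessLib

/-!
# [CombGC] Prop. 1.2 (i), (ii) at every origin from the Thm. 1.6 (iii) inputs, Rmk. 1.1.5, and the edge-like separating coverings alone

Mochizuki, *A combinatorial version of the Grothendieck conjecture*, Tohoku Math. J. **59** (2007)
[CombGC], Proposition 1.2 (Commensurable Terminality), author's manuscript p. 8: "(i) If `A₁ ∩ A₂` is
open in `A₁`, then `v₁ = v₂` (respectively, `e₁ = e₂`) … (ii) The `Aᵢ` (respectively, `Bᵢ`) are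
commensurably terminal in `Π_G` (respectively, `Π_G`; `Π^unr_G`)", and its PROOF, p. 9 (reduction to the
separating coverings) [cite: MochizukiCombGC2007, Prop 1.2 pp.8-9].

PROOF-ONLY file (abc-iut cell, FACT-LIST rows F-0459 `PSCDatum.OpenInterDeterminesComponentHolds` and
F-0438 `PSCDatum.CommensurableTerminalityHolds` = Prop. 1.2 (i), (ii) as printed over the origin parameter
`Ω`, typed by abc-iut-L3-t4 in `PSCGraphicity.lean`; universal closures over `Ω` refuted in
`PSCGraphicityOriginClosure.lean`; derived from the FULL separating-coverings row
`SeparatingCoveringsHolds Ω` (F-2830 = verticial F-2826 ∧ edge-like F-2827 ∧ unramified F-2828) by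
abc-iut-w5-d183 in `PSCSeparatingCoveringsProofs2.lean`).  This file ASSEMBLES the two rows at every
origin from:
* the origin statements the cell binds by name for [CombGC] Thm. 1.6 (iii)
  (`PSCThm16iiiAssemblyProofs.unrVerticialIff_holds_of_inputs`): "coverings of PSC-type data are of
  PSC-type" `RestrictBDOfPSCTypeHolds Ω`, [IUTchI] Rmk. 1.2.3 (iv) `UnrVerticialCharacterizationHolds' Ω`
  (or the frozen F-1938 `UnrVerticialCharacterizationHolds Ω`), Rmk. 1.1.5's rank statement
  `UnrVertAbOfRankHolds Ω`, and profiniteness of the `Π_G` of `Ω`-data (displayed `hprof`);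
* [CombGC] Rmk. 1.1.5 `SturdyCoverHolds Ω` (a sturdy characteristic covering; rank-sturdy = genus-sturdy);
* ONLY the EDGE-LIKE separating statement, row F-2827 `EdgeLikeSeparatingCoverings` at `Ω` (displayed
  `hedge`; it needs the structure of the edge module `M^edge`, [CombGC] Prop. 1.3, which the tree does
  not type) —
the VERTICIAL third of the separating step being DERIVED in
`PSCSeparatingCoveringsOfVertexQuotients.lean` (abc-iut-f-165, `verticialSeparatingCoverings_of_origin'`)
and the UNRAMIFIED third, at the `Π^unr_G`-levels where it is consumed, in
`PSCSeparatingCoveringsUnrOfVertexQuotients.lean` / `PSCSeparatingCoveringsUnrConsumers.lean`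
(abc-iut-f-166, `prop12_unr_of_origin'`).  Contents: `openInterDeterminesComponentHolds_of_inputs`
(F-0459), `commensurableTerminalityHolds_of_inputs` (F-0438), and the pair with the frozen F-1938 binder
(`prop12Holds_of_inputs_frozen`).  NET EFFECT for a certificate binding the Thm. 1.6 (iii) inputs and
`SturdyCoverHolds`: the [CombGC] Prop. 1.2 rows F-0438 / F-0459 reduce to the single origin-level
statement F-2827.  0 definitions; typed ≠ proved for the inputs; a FACT row is an assumption label;
nothing here takes a side on [IUTchIII] Cor. 3.12.
-/

namespace Literature.AnabelianGeometry.SemiGraphs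

namespace PSCDatum

universe u

variable (Ω : PSCOrigin.{u})

/-- **Row F-0459 `OpenInterDeterminesComponentHolds Ω` ([CombGC] Prop. 1.2 (i) as printed) from the
named inputs** `RestrictBDOfPSCTypeHolds Ω`, `SturdyCoverHolds Ω`, `UnrVerticialCharacterizationHolds' Ω`,
`UnrVertAbOfRankHolds Ω`, profiniteness, and the edge-like separating statement F-2827 at `Ω`.
[cite: MochizukiCombGC2007, Prop 1.2(i) p.8] -/
theorem openInterDeterminesComponentHolds_of_inputs
    (hres : RestrictBDOfPSCTypeHolds Ω) (hstc : SturdyCoverHolds Ω)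
    (hunr : UnrVerticialCharacterizationHolds' Ω) (hrank : UnrVertAbOfRankHolds Ω)
    (hedge : ∀ ⦃Q : Type u⦄ [Group Q] [TopologicalSpace Q] [IsTopologicalGroup Q] (G : PSCDatum Q),
      Ω.IsOfPSCType G → G.EdgeLikeSeparatingCoverings)
    (hprof : ∀ ⦃Q : Type u⦄ [Group Q] [TopologicalSpace Q] [IsTopologicalGroup Q] (G : PSCDatum Q),
      Ω.IsOfPSCType G → CompactSpace Q ∧ TotallyDisconnectedSpace Q) :
    OpenInterDeterminesComponentHolds Ω := by
  intro Q _ _ _ G hG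
  obtain ⟨hc, htd⟩ := hprof G hG
  have hV : G.VerticialSeparatingCoverings :=
    verticialSeparatingCoverings_of_origin' Ω hres hstc hunr hrank hprof G hG
  exact ⟨G.verticialOpenInterDeterminesVertex_of_separating hV,
    G.edgeLikeOpenInterDeterminesEdge_of_separating (hedge G hG),
    (prop12_unr_of_origin' Ω hres hunr hrank hprof G hG).1⟩

/-- **Row F-0438 `CommensurableTerminalityHolds Ω` ([CombGC] Prop. 1.2 (ii) as printed) from the same
named inputs** and the edge-like separating statement F-2827 at `Ω`.
[cite: MochizukiCombGC2007, Prop 1.2(ii) p.8] -/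
theorem commensurableTerminalityHolds_of_inputs
    (hres : RestrictBDOfPSCTypeHolds Ω) (hstc : SturdyCoverHolds Ω)
    (hunr : UnrVerticialCharacterizationHolds' Ω) (hrank : UnrVertAbOfRankHolds Ω)
    (hedge : ∀ ⦃Q : Type u⦄ [Group Q] [TopologicalSpace Q] [IsTopologicalGroup Q] (G : PSCDatum Q),
      Ω.IsOfPSCType G → G.EdgeLikeSeparatingCoverings)
    (hprof : ∀ ⦃Q : Type u⦄ [Group Q] [TopologicalSpace Q] [IsTopologicalGroup Q] (G : PSCDatum Q),
      Ω.IsOfPSCType G → CompactSpace Q ∧ TotallyDisconnectedSpace Q) :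
    CommensurableTerminalityHolds Ω := by
  intro Q _ _ _ G hG
  obtain ⟨hc, htd⟩ := hprof G hG
  have hV : G.VerticialSeparatingCoverings :=
    verticialSeparatingCoverings_of_origin' Ω hres hstc hunr hrank hprof G hG
  exact ⟨G.verticialEdgeLikeCommensurablyTerminal_of_separating hV (hedge G hG),
    (prop12_unr_of_origin' Ω hres hunr hrank hprof G hG).2⟩

/-- **Both rows with the FROZEN `UnrVerticialCharacterizationHolds Ω` (F-1938)** — the binder of
`PSCThm16iiiAssemblyProofs.unrVerticialIff_holds_of_inputs` — in place of its successor (it implies the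
successor for all data, `UnrVerticialCharacterizationHolds.toPrime`). [cite: MochizukiCombGC2007, Prop 1.2 pp.8-9] -/
theorem prop12Holds_of_inputs_frozen
    (hres : RestrictBDOfPSCTypeHolds Ω) (hstc : SturdyCoverHolds Ω)
    (hunr : UnrVerticialCharacterizationHolds Ω) (hrank : UnrVertAbOfRankHolds Ω)
    (hedge : ∀ ⦃Q : Type u⦄ [Group Q] [TopologicalSpace Q] [IsTopologicalGroup Q] (G : PSCDatum Q),
      Ω.IsOfPSCType G → G.EdgeLikeSeparatingCoverings)
    (hprof : ∀ ⦃Q : Type u⦄ [Group Q] [TopologicalSpace Q] [IsTopologicalGroup Q] (G : PSCDatum Q),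
      Ω.IsOfPSCType G → CompactSpace Q ∧ TotallyDisconnectedSpace Q) :
    OpenInterDeterminesComponentHolds Ω ∧ CommensurableTerminalityHolds Ω :=
  ⟨openInterDeterminesComponentHolds_of_inputs Ω hres hstc hunr.toPrime hrank hedge hprof,
    commensurableTerminalityHolds_of_inputs Ω hres hstc hunr.toPrime hrank hedge hprof⟩

/-- **The separating-coverings reduction, restated as a shrink of abc-iut-w5-d183's hypothesis**: where
`PSCSeparatingCoveringsProofs2.commensurableTerminalityHolds_of_separating` takes the full row F-2830
`SeparatingCoveringsHolds Ω`, the named inputs leave only its edge-like conjunct to assume — recorded as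
the implication "F-2827 at `Ω` ⇒ F-0459 ∧ F-0438" under the named inputs.
[cite: MochizukiCombGC2007, Prop 1.2 pp.8-9] -/
theorem prop12Holds_of_edgeLikeSeparating
    (hres : RestrictBDOfPSCTypeHolds Ω) (hstc : SturdyCoverHolds Ω)
    (hunr : UnrVerticialCharacterizationHolds' Ω) (hrank : UnrVertAbOfRankHolds Ω)
    (hprof : ∀ ⦃Q : Type u⦄ [Group Q] [TopologicalSpace Q] [IsTopologicalGroup Q] (G : PSCDatum Q),
      Ω.IsOfPSCType G → CompactSpace Q ∧ TotallyDisconnectedSpace Q) :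
    (∀ ⦃Q : Type u⦄ [Group Q] [TopologicalSpace Q] [IsTopologicalGroup Q] (G : PSCDatum Q),
      Ω.IsOfPSCType G → G.EdgeLikeSeparatingCoverings) →
    OpenInterDeterminesComponentHolds Ω ∧ CommensurableTerminalityHolds Ω := fun hedge =>
  ⟨openInterDeterminesComponentHolds_of_inputs Ω hres hstc hunr hrank hedge hprof,
    commensurableTerminalityHolds_of_inputs Ω hres hstc hunr hrank hedge hprof⟩

end PSCDatum

end Literature.AnabelianGeometry.SemiGraphs
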